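import Summits.ResolutionOfSingularities.ResolutionOfSingularities.Theorems.EquisingularLiftEquisingularLiftNatChartLiftDiffSections
import Summits.ResolutionOfSingularities.ResolutionOfSingularities.Theorems.EquisingularLiftEquisingularLiftNatChartCocycleCorrection
import Summits.ResolutionOfSingularities.ResolutionOfSingularities.Theorems.EquisingularLiftEquisingularLiftNatIdealSheafGlueFamily
import Summits.ResolutionOfSingularities.ResolutionOfSingularities.Theorems.EquisingularLiftEquisingularLiftNatFlatOnCharts
import Literature.AlgebraicGeometry.Morphisms.CechModuleCoverIndependence
import Literature.AlgebraicGeometry.Modules.SheafHomCoh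
import HarnessLib

/-!
# [OURS · L1 W4.5(b) · EL♮(3) · J1c (π) brick F6b] The patching engine: chart lifts with `Ȟ¹(𝒩) = 0` glue to a flat lift

Crux chain w45b (cell `res-hironaka`, slot W4.5(b)), child crux **EL♮(3)** = stmt-ResolutionOfSingularities-20148; J1 = `EmbeddedInfinitesimalLiftFact`
(p596985), discharge programme J1c, brick **(π)** (patching engine, res-type-027 g17; object split STATUS 2026-08-28T05:26Z, CHAIN v7.49 §7). OURS; NOT a
statement of H. Hironaka's 2017 manuscript; AI-written, gate-checked, weaker than expert review. No `sorry`; standard axioms; DEF-FREE (the trace charts and the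
chart-level F5 wrappers are in part 1, …NatChartLiftDiffSections). `--supports stmt-ResolutionOfSingularities-20148 --as helper`.

This is R. Hartshorne, *Deformation Theory* (2010), proof of Thm. 6.2 (b) («… the differences define a Čech 1-cocycle … if it is a coboundary we can
modify the local choices so that they glue»), for one principal small extension `X_n ↪ X_{n+1}` of infinitesimal neighbourhoods (general tower
`f : X ⟶ Spec A`, `I`, fibre model `(j₀, t₀)` over `q : A ↠ k₀`; J1's instance `A = O` a DVR): GIVEN chart lifts of `Y_n ↪ X_n` on small affine charts
covering `X_{n+1}` (F6a `IsChartLift`; supplied at the points of `Y₀` by res-L1-w45b-stub-4's B4 `exists_affine_chartLift` p610186), and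
`Ȟ¹ = 0` for the normal sheaf `𝒩` of `ι : Y₀ ↪ X₀` on a two-piece affine cover, THERE IS an ideal sheaf `C` on `X_{n+1}` with `C.comap t = jn.ker` and
`V(C) → Spec (A/I^{n+2})` flat — the input of (γ♯) `exists_closedImmersion_flat_isPullback_of_idealSheafData` (p602990).
Assembly: difference sections of restricted lifts on the affine sub-charts (F5 `exists_isDiffSec`, unique, restricting by `isDiffSec_restrict`,
additive by `isDiffSec_add`) ⟶ a Čech 1-cocycle of `𝒩` on the traces (res-L1-w45b-lead-1's F6-core `exists_cochain_of_chart_differences`,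
p609951, over F2) ⟶ a coboundary (J1's `Subsingleton (CechMH1 …)` through the tree's `cechMZ1_le_cechMB1_of_refine`) ⟶ corrected lifts
(F5 `exists_lift_isDiffSec`) agreeing on overlaps (F5 `eq_of_isDiffSec_zero`) ⟶ glued ideal sheaf (F3 `exists_idealSheafData_forall_ideal_eq_family`)
⟶ `comap t = jn.ker` and flatness on the chart cover (B1 `comap_ideal_chart`, B2's chart argument).

References (method / index only): R. Hartshorne, *Deformation Theory* (2010), Thm. 6.2 and its proof pp. 47–49; R. Hartshorne, *Algebraic Geometry*
(1977), III §4.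
-/

set_option linter.dupNamespace false -- mandated namespace `Summit.<Summit>.<Problem>` of this single-conjunct summit
-- `TopCat.Presheaf`/`Scheme.Modules` are not reducible (as in Mathlib's `AlgebraicGeometry/Modules` and the tree's `Modules/*`).
set_option backward.isDefEq.respectTransparency false

noncomputable section

open CategoryTheory CategoryTheory.Limits AlgebraicGeometry Opposite TopologicalSpace
open Literature.AlgebraicGeometry.Morphisms Literature.AlgebraicGeometry.Modules Literature.AlgebraicGeometry.Deformation
open Literature.AlgebraicGeometry.HodgeTheory

namespace Summit.ResolutionOfSingularities.ResolutionOfSingularities.Cruxes.EquisingularLiftNat.Sections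

universe u

/-! ## The patching theorem -/

section Patching

variable {A : Type} [CommRing A] {I : Ideal A} {X : Scheme.{0}} {f : X ⟶ Spec (.of A)} {n : ℕ} {k₀ : Type} [CommRing k₀] {q : A →+* k₀}
  {hq : Function.Surjective q} {hI : I ≤ RingHom.ker q} {X₀ : Scheme.{0}} {j₀ : X₀ ⟶ X} {t₀ : X₀ ⟶ Spec (.of k₀)}
  {hsq : IsPullback j₀ t₀ f (Spec.map (CommRingCat.ofHom q))} {Yn Y₀ : Scheme.{0}} {jn : Yn ⟶ infinitesimalNeighbourhood I f n}
  [IsClosedImmersion jn] {ι : Y₀ ⟶ X₀} [IsClosedImmersion ι] [IsLocallyNoetherian X₀] {s₀ : Y₀ ⟶ Yn}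
  (hs₀ : IsPullback s₀ ι (jn ≫ infinitesimalNeighbourhood.ι I f n) j₀)
  {ε : A ⧸ I ^ (n + 1 + 1)} (hkert : RingHom.ker (infinitesimalNeighbourhood.transitionRingHom I n) = Ideal.span {ε})
  (hann : ∀ c : A ⧸ I ^ (n + 1 + 1), ε * c = 0 ↔ c ∈ (RingHom.ker q).map (Ideal.Quotient.mk (I ^ (n + 1 + 1))))
  (hεm : ε ∈ (RingHom.ker q).map (Ideal.Quotient.mk (I ^ (n + 1 + 1))))
  (hnil : IsNilpotent ((RingHom.ker q).map (Ideal.Quotient.mk (I ^ (n + 1 + 1)))))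

include hs₀ hkert hann hεm hnil in
/-- **The patching engine (π).** Let `t : X_n ↪ X_{n+1}` be a step of the infinitesimal tower of `f : X ⟶ Spec A` along `I` whose base kernel
`ker (A/I^{n+2} → A/I^{n+1})` is principal, generated by `ε` with `ann ε = (ker q)/I^{n+2} ∋ ε` nilpotent; `jn : Y_n ↪ X_n` closed; `ι : Y₀ ↪ X₀` the
special fibre (`Y₀ = Y_n ×_X X₀` over a fibre model `(j₀, t₀)` of `q : A ↠ k₀`). Suppose the normal sheaf `𝒩` of `ι` has `Ȟ¹ = 0` on a cover
`V` of `Y₀` by affine opens, and that every point of `X_{n+1}` has an affine chart with an lci trace and a chart lift (F6a `IsChartLift`). Then there is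
an ideal sheaf `C` on `X_{n+1}` with `C.comap t = jn.ker` and `V(C) → Spec (A/I^{n+2})` flat.
[cite: Hartshorne2010, Thm. 6.2 (b) (proof: «the differences form a Čech 1-cocycle …»)] -/
theorem exists_idealSheafData_comap_eq_ker_and_flat {JJ : Type} [Nonempty JJ] (V : JJ → Y₀.Opens) (hVaff : ∀ j, IsAffineOpen (V j))
    (hVcov : ⨆ j, V j = ⊤) (hH1 : Subsingleton (CechMH1 Y₀.toSpecΓ (normalSheaf ι) V))
    (hcharts : ∀ x : infinitesimalNeighbourhood I f (n + 1), ∃ U : (infinitesimalNeighbourhood I f (n + 1)).affineOpens,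
      x ∈ (U : (infinitesimalNeighbourhood I f (n + 1)).Opens) ∧ HasLciTrace I f n q hq hI hsq ι U ∧ ∃ J, IsChartLift I f n jn U J) :
    ∃ C : (infinitesimalNeighbourhood I f (n + 1)).IdealSheafData,
      C.comap (infinitesimalNeighbourhood.transition I f n) = jn.ker ∧
        Flat (C.subschemeι ≫ infinitesimalNeighbourhood.toSpec I f (n + 1)) := by
  classical
  haveI hfE := isClosedImmersion_fibreEmb I f q hI hsq hq n
  haveI ht := isClosedImmersion_transition I f n
  haveI : IsLocallyNoetherian Y₀ := LocallyOfFiniteType.isLocallyNoetherian ι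
  -- the closed immersion `g : Y₀ ↪ X_{n+1}` and its preimages
  set g : Y₀ ⟶ infinitesimalNeighbourhood I f (n + 1) := ι ≫ fibreEmb I f q hI hsq n ≫ infinitesimalNeighbourhood.transition I f n with hg
  haveI : IsClosedImmersion g := by rw [hg]; infer_instance
  have hgpre : ∀ U : (infinitesimalNeighbourhood I f (n + 1)).Opens,
      g ⁻¹ᵁ U = ι ⁻¹ᵁ (fibreEmb I f q hI hsq n ⁻¹ᵁ ((infinitesimalNeighbourhood.transition I f n) ⁻¹ᵁ U)) := fun U => by
    rw [hg, Scheme.Hom.comp_preimage, Scheme.Hom.comp_preimage]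
  -- the chart predicate and its downward closure
  let Q : (infinitesimalNeighbourhood I f (n + 1)).Opens → Prop := fun U => ∃ hU : IsAffineOpen U, HasLciTrace I f n q hq hI hsq ι ⟨U, hU⟩ ∧ ∃ J, IsChartLift I f n jn ⟨U, hU⟩ J
  have hQ : ∀ (U U' : (infinitesimalNeighbourhood I f (n + 1)).Opens), Q U → U' ≤ U → IsAffineOpen U' → Q U' := by
    rintro U U' ⟨hU, hl, J, hJ⟩ hle hU'
    exact ⟨hU', hl.mono (U := ⟨U, hU⟩) (U' := ⟨U', hU'⟩) hle, _, hJ.restrict (U := ⟨U, hU⟩) (U' := ⟨U', hU'⟩) hle⟩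
  -- the small charts: affine, with the chart property, inside some `complOpens g (V j)`
  let S : Type := {U : (infinitesimalNeighbourhood I f (n + 1)).affineOpens // Q U ∧ ∃ j, (U : (infinitesimalNeighbourhood I f (n + 1)).Opens) ≤ complOpens g (V j)}
  let 𝒰 : S → (infinitesimalNeighbourhood I f (n + 1)).Opens := fun a => (a.1 : (infinitesimalNeighbourhood I f (n + 1)).Opens)
  have hS : ∀ x : infinitesimalNeighbourhood I f (n + 1), ∃ a : S, x ∈ 𝒰 a := by
    intro x
    obtain ⟨U₀, hx₀, hl₀, J₀, hJ₀⟩ := hcharts x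
    obtain ⟨j, hj⟩ := exists_mem_complOpens g V hVcov x
    obtain ⟨U, ⟨hUaff, hQU⟩, hxU, hUle⟩ := exists_affine_chart_le_of_mem Q hQ (U₀ := (U₀ : (infinitesimalNeighbourhood I f (n + 1)).Opens)) (V := complOpens g (V j))
      ⟨U₀.2, hl₀, J₀, hJ₀⟩ hx₀ hj
    exact ⟨⟨⟨U, hUaff⟩, hQU, j, hUle⟩, hxU⟩
  have hcov𝒰 : ∀ a, ∀ x ∈ 𝒰 a, ∃ U : (infinitesimalNeighbourhood I f (n + 1)).Opens, IsAffineOpen U ∧ Q U ∧ x ∈ U ∧ U ≤ 𝒰 a := fun a x hx =>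
    ⟨𝒰 a, a.1.2, a.2.1, hx, le_rfl⟩
  -- choices on the charts: the lift, the index of the two-piece cover
  have hJa : ∀ a : S, ∃ J, IsChartLift I f n jn a.1 J := fun a => by obtain ⟨_, _, J, hJ⟩ := a.2.1; exact ⟨J, hJ⟩
  choose J hJ using hJa
  have hla : ∀ a : S, HasLciTrace I f n q hq hI hsq ι a.1 := fun a => by obtain ⟨_, hl, _⟩ := a.2.1; exact hl
  choose jidx hjidx using fun a : S => a.2.2
  -- restricted lifts on affine sub-charts
  have hQaff : ∀ {U : (infinitesimalNeighbourhood I f (n + 1)).Opens} (hU : IsAffineOpen U), Q U → HasLciTrace I f n q hq hI hsq ι ⟨U, hU⟩ := by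
    rintro U hU ⟨_, hl, _⟩; exact hl
  -- the difference sections: for an affine `Q`-chart `U ≤ 𝒰 a ⊓ 𝒰 b`
  have hdiff : ∀ (a b : S) (U : (infinitesimalNeighbourhood I f (n + 1)).Opens) (hU : IsAffineOpen U) (hQU : Q U) (hle : U ≤ 𝒰 a ⊓ 𝒰 b),
      letI := chartAlg I f (n + 1) ⟨U, hU⟩
      ∃! μ : (conormalSheaf ι).over (ι ⁻¹ᵁ (traceChart I f n q hq hI hsq ⟨U, hU⟩ : X₀.Opens)) ⟶
          (unitModule Y₀).over (ι ⁻¹ᵁ (traceChart I f n q hq hI hsq ⟨U, hU⟩ : X₀.Opens)),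
        IsDiffSec ι ε (traceHom I f n q hI hsq ⟨U, hU⟩) ((J a).map ((infinitesimalNeighbourhood I f (n + 1)).presheaf.map (homOfLE (hle.trans inf_le_left)).op).hom)
          ((J b).map ((infinitesimalNeighbourhood I f (n + 1)).presheaf.map (homOfLE (hle.trans inf_le_right)).op).hom) μ := fun a b U hU hQU hle =>
    existsUnique_isDiffSec_of_isChartLift hs₀ hkert hann hεm (hQaff hU hQU)
      ((hJ a).restrict (U' := ⟨U, hU⟩) (hle.trans inf_le_left)) ((hJ b).restrict (U' := ⟨U, hU⟩) (hle.trans inf_le_right))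
  -- transport between `g⁻¹U` and `ι⁻¹(traceChart U)` (the same open)
  have hgtr : ∀ (U : (infinitesimalNeighbourhood I f (n + 1)).Opens) (hU : IsAffineOpen U), g ⁻¹ᵁ U = ι ⁻¹ᵁ (traceChart I f n q hq hI hsq ⟨U, hU⟩ : X₀.Opens) := fun U hU => hgpre U
  -- restriction of sections of the normal sheaf, as the linear maps `MSections.res` (any proof of the inclusion; they compose freely)
  have hresdef : ∀ {A B : Y₀.Opens} (h : A ≤ B) (x : Γ(normalSheaf ι, B)),
      (normalSheaf ι).presheaf.map (homOfLE h).op x = MSections.res Y₀.toSpecΓ (normalSheaf ι) h x := fun h x => rfl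
  have hrestr : ∀ {A B : Y₀.Opens} (h : A ≤ B) (μ : (conormalSheaf ι).over B ⟶ (unitModule Y₀).over B),
      restrictHom (homOfLE h) μ = MSections.res Y₀.toSpecΓ (normalSheaf ι) h μ := fun h μ => rfl
  -- the chartwise difference sections, transported to `g⁻¹U`
  let d₀ : ∀ (a b : S) (U : (infinitesimalNeighbourhood I f (n + 1)).Opens) (hU : IsAffineOpen U) (hQU : Q U) (hle : U ≤ 𝒰 a ⊓ 𝒰 b),
      ((conormalSheaf ι).over (ι ⁻¹ᵁ (traceChart I f n q hq hI hsq ⟨U, hU⟩ : X₀.Opens)) ⟶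
        (unitModule Y₀).over (ι ⁻¹ᵁ (traceChart I f n q hq hI hsq ⟨U, hU⟩ : X₀.Opens))) := fun a b U hU hQU hle => (hdiff a b U hU hQU hle).exists.choose
  have hd₀ : ∀ (a b : S) (U : (infinitesimalNeighbourhood I f (n + 1)).Opens) (hU : IsAffineOpen U) (hQU : Q U) (hle : U ≤ 𝒰 a ⊓ 𝒰 b),
      letI := chartAlg I f (n + 1) ⟨U, hU⟩
      IsDiffSec ι ε (traceHom I f n q hI hsq ⟨U, hU⟩) ((J a).map ((infinitesimalNeighbourhood I f (n + 1)).presheaf.map (homOfLE (hle.trans inf_le_left)).op).hom)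
        ((J b).map ((infinitesimalNeighbourhood I f (n + 1)).presheaf.map (homOfLE (hle.trans inf_le_right)).op).hom) (d₀ a b U hU hQU hle) :=
    fun a b U hU hQU hle => (hdiff a b U hU hQU hle).exists.choose_spec
  have hd₀u : ∀ (a b : S) (U : (infinitesimalNeighbourhood I f (n + 1)).Opens) (hU : IsAffineOpen U) (hQU : Q U) (hle : U ≤ 𝒰 a ⊓ 𝒰 b)
      (μ : (conormalSheaf ι).over (ι ⁻¹ᵁ (traceChart I f n q hq hI hsq ⟨U, hU⟩ : X₀.Opens)) ⟶
        (unitModule Y₀).over (ι ⁻¹ᵁ (traceChart I f n q hq hI hsq ⟨U, hU⟩ : X₀.Opens))),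
      (letI := chartAlg I f (n + 1) ⟨U, hU⟩
       IsDiffSec ι ε (traceHom I f n q hI hsq ⟨U, hU⟩) ((J a).map ((infinitesimalNeighbourhood I f (n + 1)).presheaf.map (homOfLE (hle.trans inf_le_left)).op).hom)
        ((J b).map ((infinitesimalNeighbourhood I f (n + 1)).presheaf.map (homOfLE (hle.trans inf_le_right)).op).hom) μ) → μ = d₀ a b U hU hQU hle :=
    fun a b U hU hQU hle μ hμ => (hdiff a b U hU hQU hle).unique hμ (hd₀ a b U hU hQU hle)
  let d : ∀ (a b : S) (U : (infinitesimalNeighbourhood I f (n + 1)).Opens), IsAffineOpen U → Q U → U ≤ 𝒰 a ⊓ 𝒰 b → Γ(normalSheaf ι, g ⁻¹ᵁ U) := fun a b U hU hQU hle =>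
    MSections.res Y₀.toSpecΓ (normalSheaf ι) (hgtr U hU).le (d₀ a b U hU hQU hle)
  have hd_def : ∀ (a b : S) (U : (infinitesimalNeighbourhood I f (n + 1)).Opens) (hU : IsAffineOpen U) (hQU : Q U) (hle : U ≤ 𝒰 a ⊓ 𝒰 b),
      d a b U hU hQU hle = MSections.res Y₀.toSpecΓ (normalSheaf ι) (hgtr U hU).le (d₀ a b U hU hQU hle) := fun _ _ _ _ _ _ => rfl
  -- restriction of ideals composes
  have hJmm : ∀ {U₁ U₂ U₃ : (infinitesimalNeighbourhood I f (n + 1)).Opens} (h₁₂ : U₂ ≤ U₁) (h₂₃ : U₃ ≤ U₂)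
      (K : Ideal Γ(infinitesimalNeighbourhood I f (n + 1), U₁)),
      (K.map ((infinitesimalNeighbourhood I f (n + 1)).presheaf.map (homOfLE h₁₂).op).hom).map
          ((infinitesimalNeighbourhood I f (n + 1)).presheaf.map (homOfLE h₂₃).op).hom =
        K.map ((infinitesimalNeighbourhood I f (n + 1)).presheaf.map (homOfLE (h₂₃.trans h₁₂)).op).hom := fun h₁₂ h₂₃ K => by
    rw [Ideal.map_map, ← CommRingCat.hom_comp, ← Functor.map_comp]
    rfl
  -- (hd) compatibility of the differences with restriction to a smaller chart
  have hd : ∀ (a b : S) (U U' : (infinitesimalNeighbourhood I f (n + 1)).Opens) (hU : IsAffineOpen U) (hQU : Q U) (hU' : IsAffineOpen U') (hQU' : Q U')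
      (hle : U ≤ 𝒰 a ⊓ 𝒰 b) (hle' : U' ≤ 𝒰 a ⊓ 𝒰 b) (k : U' ≤ U),
      (normalSheaf ι).presheaf.map (homOfLE (g.preimage_mono k)).op (d a b U hU hQU hle) = d a b U' hU' hQU' hle' := by
    intro a b U U' hU hQU hU' hQU' hle hle' k
    -- the restricted difference section is the difference section of the restricted lifts
    have hr := isDiffSec_restrict_of_isChartLift (U := ⟨U, hU⟩) (U' := ⟨U', hU'⟩) hs₀ hkert hann hεm k (hQaff hU hQU)
      ((hJ a).restrict (U' := ⟨U, hU⟩) (hle.trans inf_le_left)) ((hJ b).restrict (U' := ⟨U, hU⟩) (hle.trans inf_le_right)) (hd₀ a b U hU hQU hle)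
    rw [hJmm, hJmm] at hr
    have heq := hd₀u a b U' hU' hQU' hle' _ hr
    -- bookkeeping of the transports
    rw [hresdef, hd_def a b U hU hQU hle, hd_def a b U' hU' hQU' hle', ← heq, hrestr, MSections.res_res]
    exact ((MSections.res_res _ _ _ _ _).trans (MSections.res_eq_res _ _ _ _ _)).symm
  -- (hadd) chartwise additivity of the differences
  have hadd : ∀ (a b c : S) (U : (infinitesimalNeighbourhood I f (n + 1)).Opens) (hU : IsAffineOpen U) (hQU : Q U)
      (hab : U ≤ 𝒰 a ⊓ 𝒰 b) (hbc : U ≤ 𝒰 b ⊓ 𝒰 c) (hac : U ≤ 𝒰 a ⊓ 𝒰 c),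
      d a b U hU hQU hab + d b c U hU hQU hbc = d a c U hU hQU hac := by
    intro a b c U hU hQU hab hbc hac
    have hsum := isDiffSec_add_of_isChartLift (U := ⟨U, hU⟩) hs₀ hkert hann hεm
      ((hJ a).restrict (U' := ⟨U, hU⟩) (hab.trans inf_le_left)) ((hJ b).restrict (U' := ⟨U, hU⟩) (hab.trans inf_le_right))
      ((hJ c).restrict (U' := ⟨U, hU⟩) (hac.trans inf_le_right)) (hd₀ a b U hU hQU hab) (hd₀ b c U hU hQU hbc)
    have heq := hd₀u a c U hU hQU hac _ hsum
    rw [hd_def a b U hU hQU hab, hd_def b c U hU hQU hbc, hd_def a c U hU hQU hac, ← heq]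
    exact (map_add (MSections.res Y₀.toSpecΓ (normalSheaf ι) (hgtr U hU).le) _ _).symm
  -- `Ȟ¹ = 0` on the traces of the small charts (refinement of the two-piece cover)
  have hM : IsAffineLocalizing (normalSheaf ι) := isAffineLocalizing_sheafHom (coh_conormalSheaf ι).loc (coh_conormalSheaf ι).ft IsAffineLocalizing.unit
  haveI := hH1
  have hH1' : cechMZ1 Y₀.toSpecΓ (normalSheaf ι) (fun a => g ⁻¹ᵁ 𝒰 a) ≤ cechMB1 Y₀.toSpecΓ (normalSheaf ι) (fun a => g ⁻¹ᵁ 𝒰 a) := by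
    refine cechMZ1_le_cechMB1_of_refine Y₀.toSpecΓ hM V (fun a => g ⁻¹ᵁ 𝒰 a) jidx (fun a => ?_) hVaff (fun j y _ => ?_)
      (cechMZ1_le_cechMB1_of_subsingleton Y₀.toSpecΓ (normalSheaf ι) V)
    · rw [← preimage_complOpens g (V (jidx a))]
      exact g.preimage_mono (hjidx a)
    · obtain ⟨a, ha⟩ := hS (g.base y)
      exact Opens.mem_iSup.mpr ⟨a, ha⟩
  obtain ⟨ν, hν⟩ := exists_cochain_of_chart_differences Y₀.toSpecΓ g (normalSheaf ι) Q hQ 𝒰 hcov𝒰 d hd hadd hH1'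
  -- the corrected lifts
  let ν₀ : ∀ a : S, ((conormalSheaf ι).over (ι ⁻¹ᵁ (traceChart I f n q hq hI hsq a.1 : X₀.Opens)) ⟶
      (unitModule Y₀).over (ι ⁻¹ᵁ (traceChart I f n q hq hI hsq a.1 : X₀.Opens))) := fun a =>
    MSections.res Y₀.toSpecΓ (normalSheaf ι) (hgtr (𝒰 a) a.1.2).ge (ν a)
  have hν₀ : ∀ a : S, ν₀ a = MSections.res Y₀.toSpecΓ (normalSheaf ι) (hgtr (𝒰 a) a.1.2).ge (ν a) := fun a => rfl
  have hJ'ex := fun a : S => exists_isChartLift_isDiffSec hs₀ hkert hann hεm (hJ a) (-ν₀ a)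
  choose J' hJ'lift hJ'diff using hJ'ex
  -- the corrected lifts agree on the overlaps
  have hagree : ∀ (a b : S) (U : (infinitesimalNeighbourhood I f (n + 1)).Opens) (hU : IsAffineOpen U) (ha : U ≤ 𝒰 a) (hb : U ≤ 𝒰 b),
      (J' a).map ((infinitesimalNeighbourhood I f (n + 1)).presheaf.map (homOfLE ha).op).hom =
        (J' b).map ((infinitesimalNeighbourhood I f (n + 1)).presheaf.map (homOfLE hb).op).hom := by
    intro a b U hU ha hb
    have hQU : Q U := hQ _ _ a.2.1 ha hU
    have hJaU := (hJ a).restrict (U' := ⟨U, hU⟩) ha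
    have hJbU := (hJ b).restrict (U' := ⟨U, hU⟩) hb
    have hJ'aU := (hJ'lift a).restrict (U' := ⟨U, hU⟩) ha
    have hJ'bU := (hJ'lift b).restrict (U' := ⟨U, hU⟩) hb
    -- the three difference sections on `U`
    have s₁ := by
      have h := isDiffSec_neg_of_isChartLift (U := a.1) hkert hεm (hJ'diff a)
      rw [neg_neg] at h
      exact isDiffSec_restrict_of_isChartLift (U := a.1) (U' := ⟨U, hU⟩) hs₀ hkert hann hεm ha (hla a) (hJ'lift a) (hJ a) h
    have s₂ := hd₀ a b U hU hQU (le_inf ha hb)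
    have s₃ := isDiffSec_restrict_of_isChartLift (U := b.1) (U' := ⟨U, hU⟩) hs₀ hkert hann hεm hb (hla b) (hJ b) (hJ'lift b) (hJ'diff b)
    have s₁₂ := isDiffSec_add_of_isChartLift (U := ⟨U, hU⟩) hs₀ hkert hann hεm hJ'aU hJaU hJbU s₁ s₂
    have s₁₂₃ := isDiffSec_add_of_isChartLift (U := ⟨U, hU⟩) hs₀ hkert hann hεm hJ'aU hJbU hJ'bU s₁₂ s₃
    -- the total section vanishes: `ν a| + (ν b| - ν a|) - ν b| = 0`
    have hνU := hν a b U hU hQU (le_inf ha hb)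
    have htr : MSections.res Y₀.toSpecΓ (normalSheaf ι) (hgtr U hU).ge (d a b U hU hQU (le_inf ha hb)) = d₀ a b U hU hQU (le_inf ha hb) := by
      rw [hd_def a b U hU hQU (le_inf ha hb), MSections.res_res, MSections.res_eq_res _ _ _ (le_refl _), MSections.res_self]
    have hzero : restrictHom (homOfLE (ι.preimage_mono (traceChart_mono I f n q hq hI hsq (U' := ⟨U, hU⟩) ha))) (ν₀ a) +
        d₀ a b U hU hQU (le_inf ha hb) +
        restrictHom (homOfLE (ι.preimage_mono (traceChart_mono I f n q hq hI hsq (U' := ⟨U, hU⟩) hb))) (-ν₀ b) = 0 := by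
      rw [← htr, ← hνU, hrestr, hrestr, hν₀, hν₀, map_sub, map_neg, MSections.res_res, MSections.res_res, MSections.res_res,
        MSections.res_res,
        MSections.res_eq_res _ _ _ ((ι.preimage_mono (traceChart_mono I f n q hq hI hsq (U' := ⟨U, hU⟩) ha)).trans (hgtr (𝒰 a) a.1.2).ge) (ν a),
        MSections.res_eq_res _ _ _ ((ι.preimage_mono (traceChart_mono I f n q hq hI hsq (U' := ⟨U, hU⟩) hb)).trans (hgtr (𝒰 b) b.1.2).ge) (ν b)]
      abel
    rw [hzero] at s₁₂₃
    exact eq_of_isDiffSec_zero_of_isChartLift (hq := hq) (U := ⟨U, hU⟩) hs₀ hkert hann hεm hnil hJ'aU hJ'bU s₁₂₃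
  -- glue the corrected lifts (F3)
  let F : S → ∀ U' : (infinitesimalNeighbourhood I f (n + 1)).affineOpens, Ideal Γ(infinitesimalNeighbourhood I f (n + 1), U') := fun a U' =>
    if h : (U' : (infinitesimalNeighbourhood I f (n + 1)).Opens) ≤ 𝒰 a then (J' a).map ((infinitesimalNeighbourhood I f (n + 1)).presheaf.map (homOfLE h).op).hom else ⊤
  have hFdef : ∀ (a : S) (U' : (infinitesimalNeighbourhood I f (n + 1)).affineOpens) (h : (U' : (infinitesimalNeighbourhood I f (n + 1)).Opens) ≤ 𝒰 a), F a U' = (J' a).map ((infinitesimalNeighbourhood I f (n + 1)).presheaf.map (homOfLE h).op).hom :=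
    fun a U' h => dif_pos h
  obtain ⟨G, hG⟩ := exists_idealSheafData_forall_ideal_eq_family 𝒰 hS F
    (fun a U' U'' hU' h => by rw [hFdef a U' hU', hFdef a U'' (h.trans hU')]; exact hJmm hU' h (J' a))
    (fun a b U' hU' => by rw [hFdef a U' (hU'.trans inf_le_left), hFdef b U' (hU'.trans inf_le_right)]; exact hagree a b U' U'.2 _ _)
  have hGa : ∀ a : S, G.ideal a.1 = J' a := fun a => by
    rw [hG a a.1 le_rfl, hFdef a a.1 le_rfl]
    exact ideal_map_presheaf_map_refl a.1 (J' a)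
  refine ⟨G, ?_, ?_⟩
  · -- `G.comap t = jn.ker`, checked on the chart cover `t⁻¹(𝒰 a)`
    refine Scheme.IdealSheafData.ext_of_iSup_eq_top (fun a : S => (⟨(infinitesimalNeighbourhood.transition I f n) ⁻¹ᵁ 𝒰 a, a.1.2.preimage (infinitesimalNeighbourhood.transition I f n)⟩ :
        (infinitesimalNeighbourhood I f n).affineOpens))
      ?_ fun a => ?_
    · refine top_le_iff.mp fun y _ => ?_
      obtain ⟨a, ha⟩ := hS ((infinitesimalNeighbourhood.transition I f n).base y)
      exact Opens.mem_iSup.mpr ⟨a, ha⟩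
    · rw [comap_ideal_chart (infinitesimalNeighbourhood.transition I f n) G a.1, hGa a, ker_ideal_chart (infinitesimalNeighbourhood.transition I f n) jn a.1,
        Scheme.Hom.appLE_eq_app]
      exact (hJ'lift a).map_app_transition
  · -- flatness on the chart cover
    let 𝒱 : G.subscheme.OpenCover := Scheme.Cover.mkOfCovers S (fun a => G.subschemeCover.openCover.X a.1)
      (fun a => G.subschemeCover.openCover.f a.1) (fun y => by
        obtain ⟨a, ha⟩ := hS (G.subschemeι.base y)
        have hy : y ∈ (G.subschemeCover.f a.1).opensRange := by
          rw [G.opensRange_subschemeCover_map a.1]; exact ha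
        obtain ⟨x, hx⟩ := hy
        exact ⟨a, x, hx⟩) inferInstance
    refine IsZariskiLocalAtSource.of_openCover (P := @Flat) 𝒱 fun a => ?_
    change Flat (G.subschemeCover.openCover.f a.1 ≫ G.subschemeι ≫ infinitesimalNeighbourhood.toSpec I f (n + 1))
    have e := subschemeCover_f_subschemeι_comp (infinitesimalNeighbourhood.toSpec I f (n + 1)) G a.1
    rw [← Spec.map_comp_assoc] at e
    rw [e]
    have hflatU : ((Ideal.Quotient.mk (G.ideal a.1)).comp ((infinitesimalNeighbourhood.toSpec I f (n + 1)).appLE ⊤ a.1 le_top).hom).Flat := by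
      letI := chartAlg I f (n + 1) a.1
      rw [hGa a]
      haveI := (hJ'lift a).flat
      have h1 : (algebraMap (A ⧸ I ^ (n + 1 + 1)) (Γ(infinitesimalNeighbourhood I f (n + 1), a.1) ⧸ J' a)).Flat := RingHom.flat_algebraMap_iff.mpr inferInstance
      rw [← Ideal.Quotient.mk_comp_algebraMap, algebraMap_chartAlg] at h1
      have h2 := RingHom.Flat.comp (RingHom.Flat.of_bijective (ConcreteCategory.bijective_of_isIso (Scheme.ΓSpecIso (.of (A ⧸ I ^ (n + 1 + 1)))).hom)) h1
      rw [RingHom.comp_assoc, RingHom.comp_assoc, ← CommRingCat.hom_comp, Iso.hom_inv_id, CommRingCat.hom_id, RingHom.comp_id] at h2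
      exact h2
    haveI : Flat (Spec.map ((infinitesimalNeighbourhood.toSpec I f (n + 1)).appLE ⊤ a.1 le_top ≫ CommRingCat.ofHom (Ideal.Quotient.mk (G.ideal a.1)))) := by
      rw [HasRingHomProperty.Spec_iff (P := @Flat)]
      exact hflatU
    exact MorphismProperty.comp_mem _ _ _ this (inferInstanceAs (Flat (isAffineOpen_top (Spec _)).fromSpec))

end Patching

end Summit.ResolutionOfSingularities.ResolutionOfSingularities.Cruxes.EquisingularLiftNat.Sections

end
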